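import Literature.NumberTheory.DiophantineGeometry.CatalanGroupRingModQ
import Mathlib.RingTheory.Artinian.Module
import Mathlib.RingTheory.Idempotents
import Mathlib.Algebra.Module.Torsion.Basic
import Mathlib.LinearAlgebra.Dimension.Free
import Mathlib.FieldTheory.Finite.Basic
import HarnessLib

/-!
# `M[q] ≅ M/qM` as `𝔽_q[Γ]`-modules [Schoof2009, Proposition 13.2]

[Schoof2009, Proposition 13.2]: *let `Γ` be a finite abelian group and `q` a prime not dividing
`#Γ`; for a finite `ℤ[Γ]`-module `M` the `𝔽_q[Γ]`-modules `M[q]` and `M/qM` are isomorphic.*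
(Used in [Schoof2009, Theorem 14.1] to pass from Thaine's `Cl⁺/qCl⁺` to the `Cl⁺[q]` of
[Schoof2009, Proposition 7.4].) Schoof decomposes `ℤ_q[Γ] ≅ ∏_χ O_χ` into unramified discrete
valuation rings; we follow the same idea at finite level: `𝔽_q[Γ] = ℤ[Γ]/(q)` is a finite reduced
ring (`CatalanGroupRingModQ`), hence a product of fields `k_i` with complete orthogonal
idempotents `ε_i`; these lift to idempotents acting on `M` (modulo the nilpotent ideal
`(q)/(q^N)`), and for an idempotent `b` commuting with `q` on a finite group the pieces
`b·M[q] = (bM)[q]` and `b·(M/qM) = bM/q bM` have the same cardinality, hence the same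
`k_i`-dimension. A module over a product of fields is determined by these dimensions.

* `Catalan.Semisimple.exists_completeOrthogonalIdempotents` — idempotents `ε_𝔪` of a reduced
  Artinian ring with `𝔪 ε_𝔪 = 0`;
* `Catalan.Semisimple.nonempty_linearEquiv_of_card_fixed_eq` — two finite modules over such a ring
  whose `ε_i`-pieces have the same cardinalities are isomorphic;
* `Catalan.Semisimple.card_fixed_ker_eq_card_fixed_quotient` — `#(bM)[q] = #(bM/q bM)` for an
  idempotent action `b`;
* `Catalan.Semisimple.nonempty_ker_linearEquiv_quotient_of_isTorsionBy` — **[Schoof2009,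
  Proposition 13.2]** for `q`-primary `M` (`q^a M = 0`), as a `ℤ[Γ]`-linear isomorphism
  `ker (q·) ≃ M ⧸ range (q·)`;
* `Catalan.Semisimple.nonempty_ker_linearEquiv_quotient` — **[Schoof2009, Proposition 13.2]** for
  every finite `ℤ[Γ]`-module `M` (reduction to the `q`-primary part `M[q^N]`, `N = #M`, by Bezout).

Everything is proved; no definitions.

## References

* R. Schoof, *Catalan's Conjecture*, Universitext, Springer 2009 [Schoof2009], Proposition 13.2
  (book pp. 86–87) — held, `lit read book:schoof2009-catalan-s-conjecture` (PDF pp. 164–165).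
-/

namespace Literature.NumberTheory.DiophantineGeometry

namespace Catalan.Semisimple

open Finset

/-! ### Idempotents of a reduced Artinian ring -/

/-- A reduced commutative Artinian ring `k ≅ ∏_𝔪 k/𝔪` (`IsArtinianRing.equivPi`) has complete
orthogonal idempotents `ε_𝔪` (the unit vectors) with `𝔪 · ε_𝔪 = 0`.
[cite: Schoof2009, Chapter 13 (p. 85, "`k[Γ] ≅ ∏_χ k_χ`")] -/
theorem exists_completeOrthogonalIdempotents (k : Type*) [CommRing k] [IsArtinianRing k]
    [IsReduced k] [Fintype (MaximalSpectrum k)] [DecidableEq (MaximalSpectrum k)] :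
    ∃ ε : MaximalSpectrum k → k, CompleteOrthogonalIdempotents ε ∧
      ∀ i, ∀ m ∈ i.asIdeal, m * ε i = 0 := by
  set e := IsArtinianRing.equivPi k with he
  refine ⟨fun i => e.symm (Pi.single i 1), ?_, ?_⟩
  · exact (CompleteOrthogonalIdempotents.single
      (fun i : MaximalSpectrum k => k ⧸ i.asIdeal)).map e.symm.toRingEquiv.toRingHom
  · intro i m hm
    apply e.injective
    rw [map_mul, map_zero, AlgEquiv.apply_symm_apply]
    ext j
    rw [Pi.mul_apply, Pi.zero_apply, IsArtinianRing.equivPi_apply]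
    by_cases hij : j = i
    · subst hij
      rw [Pi.single_eq_same, mul_one]
      exact Ideal.Quotient.eq_zero_iff_mem.mpr hm
    · rw [Pi.single_eq_of_ne hij, mul_zero]

/-! ### The pieces `{x : ε x = x}` of a module -/

section Pieces

variable {k : Type*} [CommRing k]

/-- Membership in the piece `ker (1 - b) = {x : b x = x}`. [folklore] -/
theorem mem_ker_lsmul_one_sub {X : Type*} [AddCommGroup X] [Module k X] (b : k) (x : X) :
    x ∈ LinearMap.ker (LinearMap.lsmul k X (1 - b)) ↔ b • x = x := by
  rw [LinearMap.mem_ker, LinearMap.lsmul_apply, sub_smul, one_smul, sub_eq_zero, eq_comm]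

/-- If `𝔪 b = 0` then the piece `{x : b x = x}` is killed by `𝔪`. [folklore] -/
theorem isTorsionBySet_ker_lsmul_one_sub {X : Type*} [AddCommGroup X] [Module k X] {b : k}
    {𝔪 : Ideal k} (hmax : ∀ m ∈ 𝔪, m * b = 0) :
    Module.IsTorsionBySet k (LinearMap.ker (LinearMap.lsmul k X (1 - b))) 𝔪 := by
  rintro z ⟨m, hm⟩
  apply Subtype.ext
  have hz := (mem_ker_lsmul_one_sub b (z : X)).mp z.2
  change m • (z : X) = 0
  rw [← hz, smul_smul, hmax m hm, zero_smul]

/-- `#V = #F ^ dim_F V` for a finite vector space, `Nat.card` form. [folklore] -/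
theorem natCard_eq_pow_finrank (F : Type*) [Field F] [Finite F] (V : Type*) [AddCommGroup V]
    [Module F V] [Finite V] : Nat.card V = Nat.card F ^ Module.finrank F V := by
  letI := Fintype.ofFinite V
  letI := Fintype.ofFinite F
  rw [Nat.card_eq_fintype_card, Nat.card_eq_fintype_card, Module.card_eq_pow_finrank (K := F) (V := V)]

variable {ι : Type*} [Fintype ι] {ε : ι → k}

/-- For complete orthogonal idempotents `ε_i`, a module is the product of its pieces
`{x : ε_i x = x}`. [folklore] -/
theorem nonempty_linearEquiv_pi_fixed (hε : CompleteOrthogonalIdempotents ε)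
    (X : Type*) [AddCommGroup X] [Module k X] :
    Nonempty (X ≃ₗ[k] ∀ i, LinearMap.ker (LinearMap.lsmul k X (1 - ε i))) := by
  have hfix : ∀ i (x : X), ε i • (ε i • x) = ε i • x := fun i x => by
    rw [smul_smul, (hε.idem i).eq]
  set φ : X →ₗ[k] ∀ i, LinearMap.ker (LinearMap.lsmul k X (1 - ε i)) :=
    LinearMap.pi fun i => LinearMap.codRestrict _ (LinearMap.lsmul k X (ε i)) fun x =>
      (mem_ker_lsmul_one_sub _ _).mpr (hfix i x) with hφ
  have hφi : ∀ (x : X) i, ((φ x i : LinearMap.ker (LinearMap.lsmul k X (1 - ε i))) : X) =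
      ε i • x := fun x i => rfl
  refine ⟨LinearEquiv.ofBijective φ ⟨?_, ?_⟩⟩
  · rw [← LinearMap.ker_eq_bot, LinearMap.ker_eq_bot']
    intro x hx
    have h1 : ∀ i, ε i • x = 0 := fun i => by
      rw [← hφi x i, hx]
      rfl
    calc x = (∑ i, ε i) • x := by rw [hε.complete, one_smul]
      _ = 0 := by rw [Finset.sum_smul]; exact Finset.sum_eq_zero fun i _ => h1 i
  · intro y
    refine ⟨∑ i, (y i : X), ?_⟩
    funext j
    apply Subtype.ext
    rw [hφi, Finset.smul_sum, Finset.sum_eq_single j]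
    · exact (mem_ker_lsmul_one_sub _ _).mp (y j).2
    · intro i _ hij
      rw [← (mem_ker_lsmul_one_sub _ _).mp (y i).2, smul_smul, hε.ortho hij.symm, zero_smul]
    · intro h
      exact absurd (Finset.mem_univ j) h

/-- A piece `{x : ε_i x = x}` of `X` and the corresponding piece of `Y` are `k`-isomorphic as soon as
they have the same cardinality, when `𝔪 ε_i = 0` for a maximal ideal `𝔪` of finite index (both
are vector spaces over the finite field `k/𝔪`). [cite: Schoof2009, Proposition 13.2 (proof)] -/
theorem nonempty_linearEquiv_piece {b : k} (𝔪 : Ideal k) [𝔪.IsMaximal] (hmax : ∀ m ∈ 𝔪, m * b = 0)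
    [Finite (k ⧸ 𝔪)] (X : Type*) [AddCommGroup X] [Module k X] [Finite X]
    (Y : Type*) [AddCommGroup Y] [Module k Y] [Finite Y]
    (hcard : Nat.card (LinearMap.ker (LinearMap.lsmul k X (1 - b))) =
      Nat.card (LinearMap.ker (LinearMap.lsmul k Y (1 - b)))) :
    Nonempty (LinearMap.ker (LinearMap.lsmul k X (1 - b)) ≃ₗ[k]
      LinearMap.ker (LinearMap.lsmul k Y (1 - b))) := by
  letI : Field (k ⧸ 𝔪) := Ideal.Quotient.field 𝔪
  letI mX : Module (k ⧸ 𝔪) (LinearMap.ker (LinearMap.lsmul k X (1 - b))) :=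
    (isTorsionBySet_ker_lsmul_one_sub (X := X) hmax).module
  letI mY : Module (k ⧸ 𝔪) (LinearMap.ker (LinearMap.lsmul k Y (1 - b))) :=
    (isTorsionBySet_ker_lsmul_one_sub (X := Y) hmax).module
  haveI : IsScalarTower k (k ⧸ 𝔪) (LinearMap.ker (LinearMap.lsmul k X (1 - b))) :=
    (isTorsionBySet_ker_lsmul_one_sub (X := X) hmax).isScalarTower
  haveI : IsScalarTower k (k ⧸ 𝔪) (LinearMap.ker (LinearMap.lsmul k Y (1 - b))) :=
    (isTorsionBySet_ker_lsmul_one_sub (X := Y) hmax).isScalarTower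
  have hrank : Module.finrank (k ⧸ 𝔪) (LinearMap.ker (LinearMap.lsmul k X (1 - b))) =
      Module.finrank (k ⧸ 𝔪) (LinearMap.ker (LinearMap.lsmul k Y (1 - b))) := by
    rw [natCard_eq_pow_finrank (k ⧸ 𝔪) (LinearMap.ker (LinearMap.lsmul k X (1 - b))),
      natCard_eq_pow_finrank (k ⧸ 𝔪) (LinearMap.ker (LinearMap.lsmul k Y (1 - b)))] at hcard
    exact Nat.pow_right_injective (Finite.one_lt_card : 1 < Nat.card (k ⧸ 𝔪)) hcard
  exact ⟨(LinearEquiv.ofFinrankEq _ _ hrank).restrictScalars k⟩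

/-- **Modules over a finite product of fields are determined by the dimensions of their pieces.**
Let `ε_i` be complete orthogonal idempotents of `k` with `𝔪_i ε_i = 0` for maximal ideals `𝔪_i` of
finite index. If two finite `k`-modules `X, Y` have pieces `{ε_i x = x}` of the same cardinality for
every `i`, then `X ≅ Y`. [cite: Schoof2009, Proposition 13.2 (proof)] -/
theorem nonempty_linearEquiv_of_card_fixed_eq (hε : CompleteOrthogonalIdempotents ε)
    (𝔪 : ι → Ideal k) [∀ i, (𝔪 i).IsMaximal] (hmax : ∀ i, ∀ m ∈ 𝔪 i, m * ε i = 0)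
    [∀ i, Finite (k ⧸ 𝔪 i)]
    (X : Type*) [AddCommGroup X] [Module k X] [Finite X]
    (Y : Type*) [AddCommGroup Y] [Module k Y] [Finite Y]
    (hcard : ∀ i, Nat.card (LinearMap.ker (LinearMap.lsmul k X (1 - ε i))) =
      Nat.card (LinearMap.ker (LinearMap.lsmul k Y (1 - ε i)))) :
    Nonempty (X ≃ₗ[k] Y) := by
  obtain ⟨eX⟩ := nonempty_linearEquiv_pi_fixed hε X
  obtain ⟨eY⟩ := nonempty_linearEquiv_pi_fixed hε Y
  have e := fun i => (nonempty_linearEquiv_piece (𝔪 i) (hmax i) X Y (hcard i)).some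
  exact ⟨eX.trans ((LinearEquiv.piCongrRight e).trans eY.symm)⟩

end Pieces

/-! ### `#(bM)[q] = #(bM/qbM)` for an idempotent action `b` -/

/-- For commuting endomorphisms `q, b` of a finite module with `b` idempotent, the `b`-fixed parts
of `M[q] = ker q` and of `M/qM` have the same cardinality: both equal `#N/#(qN)` for `N = bM`
(`(bM) ∩ M[q] = (bM)[q]`, `bM ∩ qM = q·bM`). [cite: Schoof2009, Proposition 13.2 (proof)] -/
theorem card_fixed_ker_eq_card_fixed_quotient {A : Type*} [CommRing A] {M : Type*}
    [AddCommGroup M] [Module A M] [Finite M] (q b : A) (hb : ∀ m : M, b • b • m = b • m) :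
    Nat.card (LinearMap.ker (LinearMap.lsmul A (LinearMap.ker (LinearMap.lsmul A M q)) (1 - b))) =
      Nat.card (LinearMap.ker
        (LinearMap.lsmul A (M ⧸ LinearMap.range (LinearMap.lsmul A M q)) (1 - b))) := by
  classical
  -- `N = bM = {m : b m = m}`
  set N : Submodule A M := LinearMap.ker (LinearMap.lsmul A M (1 - b)) with hNdef
  have hmemN : ∀ m : M, m ∈ N ↔ b • m = m := fun m => mem_ker_lsmul_one_sub b m
  have hbN : ∀ m : M, b • m ∈ N := fun m => (hmemN _).mpr (hb m)
  set qN : N →ₗ[A] N := LinearMap.lsmul A N q with hqNdef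
  have hqN : ∀ n : N, ((qN n : N) : M) = q • (n : M) := fun n => rfl
  -- left-hand side `≅ ker qN`
  have hL : Nat.card (LinearMap.ker (LinearMap.lsmul A (LinearMap.ker (LinearMap.lsmul A M q))
      (1 - b))) = Nat.card (LinearMap.ker qN) := by
    refine Nat.card_congr ⟨fun x => ⟨⟨(x.1 : M), (hmemN _).mpr ?_⟩, ?_⟩,
      fun y => ⟨⟨(y.1 : M), ?_⟩, ?_⟩, fun x => rfl, fun y => rfl⟩
    · have h := (mem_ker_lsmul_one_sub b x.1).mp x.2
      exact congrArg Subtype.val h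
    · rw [LinearMap.mem_ker]
      apply Subtype.ext
      rw [hqN]
      exact (LinearMap.mem_ker.mp x.1.2 : q • (x.1 : M) = 0)
    · rw [LinearMap.mem_ker, LinearMap.lsmul_apply]
      have h := congrArg Subtype.val (LinearMap.mem_ker.mp y.2)
      rw [hqN] at h
      exact h
    · rw [mem_ker_lsmul_one_sub]
      apply Subtype.ext
      exact (hmemN _).mp y.1.2
  -- right-hand side `≅ N ⧸ range qN` via `θ : N → M/qM`
  set Q := LinearMap.range (LinearMap.lsmul A M q) with hQdef
  have hmemQ : ∀ m : M, m ∈ Q ↔ ∃ w : M, q • w = m := fun m => by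
    rw [hQdef, LinearMap.mem_range]
    rfl
  set θ : N →ₗ[A] M ⧸ Q := Q.mkQ.comp N.subtype with hθdef
  have hθ : ∀ n : N, θ n = Submodule.Quotient.mk (n : M) := fun n => rfl
  have hkerθ : LinearMap.ker θ = LinearMap.range qN := by
    ext n
    rw [LinearMap.mem_ker, hθ, Submodule.Quotient.mk_eq_zero, hmemQ, LinearMap.mem_range]
    constructor
    · rintro ⟨w, hw⟩
      refine ⟨⟨b • w, hbN w⟩, Subtype.ext ?_⟩
      rw [hqN]
      change q • b • w = (n : M)
      rw [smul_comm, hw, (hmemN _).mp n.2]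
    · rintro ⟨w, hw⟩
      exact ⟨(w : M), by rw [← hw, hqN]⟩
  have hrangeθ : Nat.card (LinearMap.ker (LinearMap.lsmul A (M ⧸ Q) (1 - b))) =
      Nat.card (LinearMap.range θ) := by
    refine Nat.card_congr (Equiv.subtypeEquivProp (funext fun y => propext ?_))
    rw [mem_ker_lsmul_one_sub, LinearMap.mem_range]
    constructor
    · intro hy
      obtain ⟨m, rfl⟩ := Submodule.Quotient.mk_surjective Q y
      refine ⟨⟨b • m, hbN m⟩, ?_⟩
      rw [hθ, Submodule.coe_mk]
      rw [← Submodule.Quotient.mk_smul] at hy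
      exact hy
    · rintro ⟨n, rfl⟩
      rw [hθ, ← Submodule.Quotient.mk_smul, (hmemN _).mp n.2]
  -- counting: `#ker qN · #range qN = #N = #range qN · #(N/range qN)`
  have h1 := Submodule.card_eq_card_quotient_mul_card (LinearMap.ker qN)
  have h2 := Submodule.card_eq_card_quotient_mul_card (LinearMap.range qN)
  have h3 : Nat.card (N ⧸ LinearMap.ker qN) = Nat.card (LinearMap.range qN) :=
    Nat.card_congr (LinearMap.quotKerEquivRange qN).toEquiv
  have h4 : Nat.card (LinearMap.range θ) = Nat.card (N ⧸ LinearMap.ker θ) :=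
    (Nat.card_congr (LinearMap.quotKerEquivRange θ).toEquiv).symm
  have hpos : 0 < Nat.card (LinearMap.range qN) := Nat.card_pos
  rw [hL, hrangeθ, h4, hkerθ]
  rw [h3] at h1
  rw [h1, mul_comm (Nat.card (LinearMap.range qN))] at h2
  exact Nat.eq_of_mul_eq_mul_right hpos h2

/-! ### [Schoof2009, Proposition 13.2] -/

/-- **[Schoof2009, Proposition 13.2], `q`-primary case.** Let `Γ` be a finite abelian group, `q` a
prime with `q ∤ #Γ`, and `M` a finite `ℤ[Γ]`-module killed by `q^a`. Then `M[q] = ker (q·)` and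
`M/qM` are isomorphic `ℤ[Γ]`-modules (equivalently `𝔽_q[Γ]`-modules).
[cite: Schoof2009, Proposition 13.2] -/
theorem nonempty_ker_linearEquiv_quotient_of_isTorsionBy {Γ : Type*} [CommGroup Γ] [Finite Γ]
    {q : ℕ} [hqp : Fact q.Prime] (hq : ¬ q ∣ Nat.card Γ)
    (M : Type*) [AddCommGroup M] [Module (MonoidAlgebra ℤ Γ) M] [Finite M] {a : ℕ} (ha : 1 ≤ a)
    (hM : Module.IsTorsionBy (MonoidAlgebra ℤ Γ) M ((q : MonoidAlgebra ℤ Γ) ^ a)) :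
    Nonempty (LinearMap.ker (LinearMap.lsmul (MonoidAlgebra ℤ Γ) M (q : MonoidAlgebra ℤ Γ))
      ≃ₗ[MonoidAlgebra ℤ Γ]
      (M ⧸ LinearMap.range (LinearMap.lsmul (MonoidAlgebra ℤ Γ) M (q : MonoidAlgebra ℤ Γ)))) := by
  classical
  -- ### the rings `k = ℤ[Γ]/(q)` (finite, reduced) and `R = ℤ[Γ]/(q^a)`
  set J : Ideal (MonoidAlgebra ℤ Γ) := Ideal.span {(q : MonoidAlgebra ℤ Γ)} with hJ
  set I : Ideal (MonoidAlgebra ℤ Γ) := Ideal.span {(q : MonoidAlgebra ℤ Γ) ^ a} with hI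
  have hIJ : I ≤ J := Ideal.span_singleton_le_span_singleton.mpr (dvd_pow_self _ (by omega))
  haveI : IsReduced (MonoidAlgebra ℤ Γ ⧸ J) := isReduced_quotient_span hq
  haveI : Finite (MonoidAlgebra ℤ Γ ⧸ J) := by
    obtain ⟨e⟩ := nonempty_quotient_span_ringEquiv (Γ := Γ) q
    haveI : Finite (MonoidAlgebra (ZMod q) Γ) :=
      Finite.of_injective (fun x : MonoidAlgebra (ZMod q) Γ => (x.coeff : Γ → ZMod q))
        fun x y h => MonoidAlgebra.ext (DFunLike.coe_injective h)
    exact Finite.of_equiv _ e.toEquiv.symm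
  letI := Fintype.ofFinite (MaximalSpectrum (MonoidAlgebra ℤ Γ ⧸ J))
  obtain ⟨ε, hε, hmax⟩ := exists_completeOrthogonalIdempotents (MonoidAlgebra ℤ Γ ⧸ J)
  -- ### lift the idempotents modulo `q^a` and choose representatives `b i ∈ ℤ[Γ]`
  set π : MonoidAlgebra ℤ Γ ⧸ I →+* MonoidAlgebra ℤ Γ ⧸ J := Ideal.Quotient.factor hIJ with hπ
  have hπnil : ∀ x ∈ RingHom.ker π, IsNilpotent x := by
    intro x hx
    obtain ⟨y, rfl⟩ := Ideal.Quotient.mk_surjective x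
    rw [RingHom.mem_ker, hπ, Ideal.Quotient.factor_mk, Ideal.Quotient.eq_zero_iff_mem, hJ,
      Ideal.mem_span_singleton] at hx
    obtain ⟨z, rfl⟩ := hx
    refine ⟨a, ?_⟩
    rw [← map_pow, Ideal.Quotient.eq_zero_iff_mem, mul_pow, hI]
    exact Ideal.mul_mem_right _ _ (Ideal.mem_span_singleton_self _)
  obtain ⟨e', he', hπe'⟩ := CompleteOrthogonalIdempotents.lift_of_isNilpotent_ker π hπnil hε
    fun i => RingHom.mem_range.mpr (Ideal.Quotient.factor_surjective hIJ (ε i))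
  choose b hb using fun i => Ideal.Quotient.mk_surjective (I := I) (e' i)
  have hbε : ∀ i, Ideal.Quotient.mk J (b i) = ε i := fun i => by
    have h1 := congrFun hπe' i
    simp only [Function.comp_apply] at h1
    rw [← h1, ← hb i, hπ, Ideal.Quotient.factor_mk]
  have hMI : Module.IsTorsionBySet (MonoidAlgebra ℤ Γ) M I :=
    (Module.isTorsionBySet_span_singleton_iff _).mpr hM
  have hbidem : ∀ i (m : M), b i • b i • m = b i • m := by
    intro i m
    have h1 : b i * b i - b i ∈ I := by
      rw [← Ideal.Quotient.eq_zero_iff_mem, map_sub, map_mul, hb i, (he'.idem i).eq, sub_self]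
    have h2 := @hMI m ⟨_, h1⟩
    change (b i * b i - b i) • m = 0 at h2
    rwa [sub_smul, mul_smul, sub_eq_zero] at h2
  -- ### `X = M[q]` and `Y = M/qM` are `k`-modules
  have hXJ : Module.IsTorsionBySet (MonoidAlgebra ℤ Γ)
      (LinearMap.ker (LinearMap.lsmul (MonoidAlgebra ℤ Γ) M (q : MonoidAlgebra ℤ Γ))) J := by
    refine (Module.isTorsionBySet_span_singleton_iff _).mpr fun x => Subtype.ext ?_
    exact LinearMap.mem_ker.mp x.2
  have hYJ : Module.IsTorsionBySet (MonoidAlgebra ℤ Γ)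
      (M ⧸ LinearMap.range (LinearMap.lsmul (MonoidAlgebra ℤ Γ) M (q : MonoidAlgebra ℤ Γ))) J := by
    refine (Module.isTorsionBySet_span_singleton_iff _).mpr fun y => ?_
    obtain ⟨m, rfl⟩ := Submodule.Quotient.mk_surjective _ y
    change (q : MonoidAlgebra ℤ Γ) • Submodule.Quotient.mk m = 0
    rw [← Submodule.Quotient.mk_smul, Submodule.Quotient.mk_eq_zero]
    exact ⟨m, rfl⟩
  letI mX : Module (MonoidAlgebra ℤ Γ ⧸ J)
      (LinearMap.ker (LinearMap.lsmul (MonoidAlgebra ℤ Γ) M (q : MonoidAlgebra ℤ Γ))) := hXJ.module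
  letI mY : Module (MonoidAlgebra ℤ Γ ⧸ J)
      (M ⧸ LinearMap.range (LinearMap.lsmul (MonoidAlgebra ℤ Γ) M (q : MonoidAlgebra ℤ Γ))) :=
    hYJ.module
  haveI : IsScalarTower (MonoidAlgebra ℤ Γ) (MonoidAlgebra ℤ Γ ⧸ J)
      (LinearMap.ker (LinearMap.lsmul (MonoidAlgebra ℤ Γ) M (q : MonoidAlgebra ℤ Γ))) :=
    hXJ.isScalarTower
  haveI : IsScalarTower (MonoidAlgebra ℤ Γ) (MonoidAlgebra ℤ Γ ⧸ J)
      (M ⧸ LinearMap.range (LinearMap.lsmul (MonoidAlgebra ℤ Γ) M (q : MonoidAlgebra ℤ Γ))) :=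
    hYJ.isScalarTower
  haveI : ∀ i : MaximalSpectrum (MonoidAlgebra ℤ Γ ⧸ J), Finite ((MonoidAlgebra ℤ Γ ⧸ J) ⧸ i.asIdeal) :=
    fun i => Finite.of_surjective _ Ideal.Quotient.mk_surjective
  haveI : Finite (M ⧸ LinearMap.range (LinearMap.lsmul (MonoidAlgebra ℤ Γ) M (q : MonoidAlgebra ℤ Γ))) :=
    Finite.of_surjective _ (Submodule.Quotient.mk_surjective _)
  -- ### compare the pieces and conclude
  suffices hcard : ∀ i, Nat.card (LinearMap.ker (LinearMap.lsmul (MonoidAlgebra ℤ Γ ⧸ J)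
      (LinearMap.ker (LinearMap.lsmul (MonoidAlgebra ℤ Γ) M (q : MonoidAlgebra ℤ Γ))) (1 - ε i))) =
      Nat.card (LinearMap.ker (LinearMap.lsmul (MonoidAlgebra ℤ Γ ⧸ J)
      (M ⧸ LinearMap.range (LinearMap.lsmul (MonoidAlgebra ℤ Γ) M (q : MonoidAlgebra ℤ Γ)))
        (1 - ε i))) by
    obtain ⟨e⟩ := nonempty_linearEquiv_of_card_fixed_eq hε (fun i => i.asIdeal) hmax
      (LinearMap.ker (LinearMap.lsmul (MonoidAlgebra ℤ Γ) M (q : MonoidAlgebra ℤ Γ)))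
      (M ⧸ LinearMap.range (LinearMap.lsmul (MonoidAlgebra ℤ Γ) M (q : MonoidAlgebra ℤ Γ))) hcard
    exact ⟨e.restrictScalars (MonoidAlgebra ℤ Γ)⟩
  intro i
  have hXpiece : Nat.card (LinearMap.ker (LinearMap.lsmul (MonoidAlgebra ℤ Γ ⧸ J)
      (LinearMap.ker (LinearMap.lsmul (MonoidAlgebra ℤ Γ) M (q : MonoidAlgebra ℤ Γ))) (1 - ε i))) =
      Nat.card (LinearMap.ker (LinearMap.lsmul (MonoidAlgebra ℤ Γ)
        (LinearMap.ker (LinearMap.lsmul (MonoidAlgebra ℤ Γ) M (q : MonoidAlgebra ℤ Γ))) (1 - b i))) := by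
    refine Nat.card_congr (Equiv.subtypeEquivProp (funext fun x => propext ?_))
    rw [mem_ker_lsmul_one_sub, mem_ker_lsmul_one_sub, ← hbε i]
    rfl
  have hYpiece : Nat.card (LinearMap.ker (LinearMap.lsmul (MonoidAlgebra ℤ Γ ⧸ J)
      (M ⧸ LinearMap.range (LinearMap.lsmul (MonoidAlgebra ℤ Γ) M (q : MonoidAlgebra ℤ Γ)))
        (1 - ε i))) =
      Nat.card (LinearMap.ker (LinearMap.lsmul (MonoidAlgebra ℤ Γ)
        (M ⧸ LinearMap.range (LinearMap.lsmul (MonoidAlgebra ℤ Γ) M (q : MonoidAlgebra ℤ Γ)))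
        (1 - b i))) := by
    refine Nat.card_congr (Equiv.subtypeEquivProp (funext fun x => propext ?_))
    rw [mem_ker_lsmul_one_sub, mem_ker_lsmul_one_sub, ← hbε i]
    rfl
  rw [hXpiece, hYpiece]
  exact card_fixed_ker_eq_card_fixed_quotient (q : MonoidAlgebra ℤ Γ) (b i) (hbidem i)

/-- **[Schoof2009, Proposition 13.2].** Let `Γ` be a finite abelian group, `q` a prime not
dividing `#Γ`, and `M` a finite `ℤ[Γ]`-module. Then the `𝔽_q[Γ]`-modules `M[q]` and `M/qM` are
isomorphic; here as a `ℤ[Γ]`-linear isomorphism `ker (q·) ≃ M ⧸ range (q·)`. (Reduction to the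
`q`-primary part `M' = M[q^N]`, `N = #M`: `M = M' ⊕ M''` with `q` invertible on `M''`, so
`M[q] = M'[q]` and `M/qM = M'/qM'`.) [cite: Schoof2009, Proposition 13.2] -/
theorem nonempty_ker_linearEquiv_quotient {Γ : Type*} [CommGroup Γ] [Finite Γ]
    {q : ℕ} [hqp : Fact q.Prime] (hq : ¬ q ∣ Nat.card Γ)
    (M : Type*) [AddCommGroup M] [Module (MonoidAlgebra ℤ Γ) M] [Finite M] :
    Nonempty (LinearMap.ker (LinearMap.lsmul (MonoidAlgebra ℤ Γ) M (q : MonoidAlgebra ℤ Γ))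
      ≃ₗ[MonoidAlgebra ℤ Γ]
      (M ⧸ LinearMap.range (LinearMap.lsmul (MonoidAlgebra ℤ Γ) M (q : MonoidAlgebra ℤ Γ)))) := by
  classical
  -- ### `N = #M = q^v c`, Bezout `s q^N + t c = 1`
  set N := Nat.card M with hNdef
  have hN0 : N ≠ 0 := (Nat.card_pos (α := M)).ne'
  have hN1 : 1 ≤ N := Nat.one_le_iff_ne_zero.mpr hN0
  obtain ⟨v, c, hqc, hNvc⟩ := Nat.exists_eq_pow_mul_and_not_dvd hN0 q hqp.out.one_lt.ne'
  have hvN : v ≤ N := by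
    have h1 : q ^ v ≤ N := by
      rw [hNvc]
      have : 0 < c := Nat.pos_of_ne_zero fun h0 => hqc (h0 ▸ dvd_zero q)
      exact Nat.le_mul_of_pos_right _ this
    exact ((Nat.lt_pow_self hqp.out.one_lt).le.trans h1)
  have hcop : Nat.Coprime (q ^ N) c :=
    Nat.Coprime.pow_left _ ((Nat.Prime.coprime_iff_not_dvd hqp.out).mpr hqc)
  obtain ⟨s, t, hst⟩ := Nat.isCoprime_iff_coprime.mpr hcop
  -- in `A = ℤ[Γ]`
  have hstA : (s : MonoidAlgebra ℤ Γ) * (q : MonoidAlgebra ℤ Γ) ^ N +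
      (t : MonoidAlgebra ℤ Γ) * (c : MonoidAlgebra ℤ Γ) = 1 := by
    have := congrArg (Int.cast : ℤ → MonoidAlgebra ℤ Γ) hst
    push_cast at this
    exact this
  have hkill : ∀ m : M, ((q : MonoidAlgebra ℤ Γ) ^ N * (c : MonoidAlgebra ℤ Γ)) • m = 0 := by
    intro m
    have h1 : (N : MonoidAlgebra ℤ Γ) • m = 0 := by
      rw [Nat.cast_smul_eq_nsmul, hNdef]
      exact card_nsmul_eq_zero'
    have h2 : (q : MonoidAlgebra ℤ Γ) ^ N * (c : MonoidAlgebra ℤ Γ) =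
        (q : MonoidAlgebra ℤ Γ) ^ (N - v) * (N : MonoidAlgebra ℤ Γ) := by
      have h3 : (N : MonoidAlgebra ℤ Γ) = (q : MonoidAlgebra ℤ Γ) ^ v * (c : MonoidAlgebra ℤ Γ) := by
        simp only [hNvc, Nat.cast_mul, Nat.cast_pow]
      rw [h3, ← mul_assoc, ← pow_add, Nat.sub_add_cancel hvN]
    rw [h2, mul_smul, h1, smul_zero]
  -- ### the `q`-primary part `M' = M[q^N]`
  set M' : Submodule (MonoidAlgebra ℤ Γ) M :=
    LinearMap.ker (LinearMap.lsmul (MonoidAlgebra ℤ Γ) M ((q : MonoidAlgebra ℤ Γ) ^ N)) with hM'def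
  have hmemM' : ∀ m : M, m ∈ M' ↔ ((q : MonoidAlgebra ℤ Γ) ^ N) • m = 0 := fun m => by
    rw [hM'def, LinearMap.mem_ker, LinearMap.lsmul_apply]
  have hM' : Module.IsTorsionBy (MonoidAlgebra ℤ Γ) M' ((q : MonoidAlgebra ℤ Γ) ^ N) :=
    fun x => Subtype.ext ((hmemM' _).mp x.2)
  -- the decomposition `m = m₁ + m₂`, `m₁ = t c m ∈ M'`, `m₂ = s q^N m ∈ qM`, `c m₂ = 0`
  have hdec1 : ∀ m : M, ((t : MonoidAlgebra ℤ Γ) * (c : MonoidAlgebra ℤ Γ)) • m ∈ M' := by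
    intro m
    rw [hmemM', smul_smul, show (q : MonoidAlgebra ℤ Γ) ^ N * ((t : MonoidAlgebra ℤ Γ) * c) =
      (t : MonoidAlgebra ℤ Γ) * ((q : MonoidAlgebra ℤ Γ) ^ N * c) by ring, mul_smul, hkill, smul_zero]
  have hdec : ∀ m : M, m = ((t : MonoidAlgebra ℤ Γ) * (c : MonoidAlgebra ℤ Γ)) • m +
      (q : MonoidAlgebra ℤ Γ) • (((s : MonoidAlgebra ℤ Γ) * (q : MonoidAlgebra ℤ Γ) ^ (N - 1)) • m) := by
    intro m
    rw [smul_smul, ← add_smul]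
    conv_lhs => rw [← one_smul (MonoidAlgebra ℤ Γ) m, ← hstA]
    congr 1
    rw [show N = N - 1 + 1 from (Nat.sub_add_cancel hN1).symm, pow_succ]
    simp only [Nat.add_sub_cancel]
    ring
  -- an element of `M'` killed by `c` is `0`
  have hzero : ∀ z : M, z ∈ M' → (c : MonoidAlgebra ℤ Γ) • z = 0 → z = 0 := by
    intro z hz hcz
    rw [hmemM'] at hz
    calc z = ((s : MonoidAlgebra ℤ Γ) * (q : MonoidAlgebra ℤ Γ) ^ N +
        (t : MonoidAlgebra ℤ Γ) * (c : MonoidAlgebra ℤ Γ)) • z := by rw [hstA, one_smul]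
      _ = 0 := by rw [add_smul, mul_smul, mul_smul, hz, hcz, smul_zero, smul_zero, add_zero]
  -- ### Proposition 13.2 for `M'`
  obtain ⟨e'⟩ := nonempty_ker_linearEquiv_quotient_of_isTorsionBy hq M' hN1 hM'
  -- ### `M[q] ≅ M'[q]`
  have hXM' : ∀ x : LinearMap.ker (LinearMap.lsmul (MonoidAlgebra ℤ Γ) M (q : MonoidAlgebra ℤ Γ)),
      (x : M) ∈ M' := by
    intro x
    rw [hmemM', show N = N - 1 + 1 from (Nat.sub_add_cancel hN1).symm, pow_succ, mul_smul,
      show (q : MonoidAlgebra ℤ Γ) • (x : M) = 0 from LinearMap.mem_ker.mp x.2, smul_zero]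
  have eX : LinearMap.ker (LinearMap.lsmul (MonoidAlgebra ℤ Γ) M' (q : MonoidAlgebra ℤ Γ))
      ≃ₗ[MonoidAlgebra ℤ Γ]
      LinearMap.ker (LinearMap.lsmul (MonoidAlgebra ℤ Γ) M (q : MonoidAlgebra ℤ Γ)) := by
    refine LinearEquiv.ofBijective
      (LinearMap.codRestrict _ (M'.subtype.comp (Submodule.subtype _)) fun y => ?_) ⟨?_, ?_⟩
    · rw [LinearMap.mem_ker, LinearMap.lsmul_apply, LinearMap.comp_apply, Submodule.coe_subtype,
        Submodule.coe_subtype]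
      exact congrArg (fun z : M' => (z : M)) (LinearMap.mem_ker.mp y.2)
    · intro y₁ y₂ h
      have h1 := congrArg (fun z :
        LinearMap.ker (LinearMap.lsmul (MonoidAlgebra ℤ Γ) M (q : MonoidAlgebra ℤ Γ)) => (z : M)) h
      exact Subtype.ext (Subtype.ext h1)
    · intro x
      refine ⟨⟨⟨(x : M), hXM' x⟩, ?_⟩, Subtype.ext rfl⟩
      rw [LinearMap.mem_ker, LinearMap.lsmul_apply]
      exact Subtype.ext (LinearMap.mem_ker.mp x.2)
  -- ### `M/qM ≅ M'/qM'` via `Θ : M' → M/qM`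
  set Q := LinearMap.range (LinearMap.lsmul (MonoidAlgebra ℤ Γ) M (q : MonoidAlgebra ℤ Γ)) with hQdef
  set Θ : M' →ₗ[MonoidAlgebra ℤ Γ] M ⧸ Q := Q.mkQ.comp M'.subtype with hΘdef
  have hΘ : ∀ n : M', Θ n = Submodule.Quotient.mk (n : M) := fun n => rfl
  have hΘsurj : Function.Surjective Θ := by
    intro y
    obtain ⟨m, rfl⟩ := Submodule.Quotient.mk_surjective Q y
    refine ⟨⟨_, hdec1 m⟩, ?_⟩
    rw [hΘ, Submodule.coe_mk, eq_comm, Submodule.Quotient.eq, hQdef, LinearMap.mem_range]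
    refine ⟨((s : MonoidAlgebra ℤ Γ) * (q : MonoidAlgebra ℤ Γ) ^ (N - 1)) • m, ?_⟩
    rw [LinearMap.lsmul_apply, eq_sub_iff_add_eq, add_comm]
    exact (hdec m).symm
  have hΘker : LinearMap.ker Θ =
      LinearMap.range (LinearMap.lsmul (MonoidAlgebra ℤ Γ) M' (q : MonoidAlgebra ℤ Γ)) := by
    ext n
    rw [LinearMap.mem_ker, hΘ, Submodule.Quotient.mk_eq_zero, hQdef, LinearMap.mem_range,
      LinearMap.mem_range]
    constructor
    · rintro ⟨w, hw⟩
      rw [LinearMap.lsmul_apply] at hw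
      -- `n = q w`, `w = w₁ + w₂`; `q w₂ ∈ M'` is killed by `c`, hence `0`
      have hw1 := hdec1 w
      set w₁ := ((t : MonoidAlgebra ℤ Γ) * (c : MonoidAlgebra ℤ Γ)) • w with hw₁
      have hww1 : w - w₁ = ((s : MonoidAlgebra ℤ Γ) * (q : MonoidAlgebra ℤ Γ) ^ N) • w := by
        rw [hw₁, sub_eq_iff_eq_add, ← add_smul, hstA, one_smul]
      have hqw2 : (q : MonoidAlgebra ℤ Γ) • (w - w₁) = 0 := by
        apply hzero
        · rw [smul_sub, hw]
          exact M'.sub_mem n.2 (M'.smul_mem _ hw1)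
        · rw [hww1, smul_smul, smul_smul,
            show (c : MonoidAlgebra ℤ Γ) * (q : MonoidAlgebra ℤ Γ) * ((s : MonoidAlgebra ℤ Γ) *
              (q : MonoidAlgebra ℤ Γ) ^ N) = ((q : MonoidAlgebra ℤ Γ) * s) *
              ((q : MonoidAlgebra ℤ Γ) ^ N * c) by ring, mul_smul, hkill, smul_zero]
      refine ⟨⟨w₁, hw1⟩, Subtype.ext ?_⟩
      change (q : MonoidAlgebra ℤ Γ) • w₁ = (n : M)
      rw [← hw, ← sub_eq_zero, ← smul_sub, ← neg_sub, smul_neg, hqw2, neg_zero]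
    · rintro ⟨w, hw⟩
      exact ⟨(w : M), by rw [← hw]; rfl⟩
  have eY : (M ⧸ Q) ≃ₗ[MonoidAlgebra ℤ Γ]
      (M' ⧸ LinearMap.range (LinearMap.lsmul (MonoidAlgebra ℤ Γ) M' (q : MonoidAlgebra ℤ Γ))) :=
    (LinearMap.quotKerEquivOfSurjective Θ hΘsurj).symm.trans (Submodule.quotEquivOfEq _ _ hΘker)
  exact ⟨eX.symm.trans (e'.trans eY.symm)⟩

end Catalan.Semisimple

end Literature.NumberTheory.DiophantineGeometry
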